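import Summits.ValiantsHypothesis.ValiantsHypothesis.Theorems.MonotoneRestorationOrbitRestorationQPBoxVolume
import Summits.ValiantsHypothesis.ValiantsHypothesis.Theorems.MonotoneRestorationOrbitRestorationQPHomogTools
import HarnessLib

/-!
# The box-volume stratum of A_∞ in the stub's own currency (multisets of affine forms)

Route MonotoneRestoration, crux `OrbitRestorationQP` (stmt-ValiantsHypothesis-18293), line `depth-three-rung`,
stub A_∞ `stub_sigmaPiSigmaValue` (and its sub-rungs A₁ / A_k, which speak of scaled products `C a * L.prod` of
multisets `L` of polynomials of total degree `≤ 1`).  Namespace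
`Summit.ValiantsHypothesis.ValiantsHypothesis.Theorems.DerivativeTower`.

`…BoxVolume.lean` proved: ΣΠΣ expressions `Σ_i a_i Π_j (ℓ_{w_ij} + b_ij)^{e_ij}` of polynomial box volume
`Σ_i Π_j (e_ij + 1)` are quasi-polynomially orbit-restorable.  Here the same statement is transported to the
multiset currency of the registered stubs: the box volume of a multiset `L` of affine forms is
`Π_{ℓ ∈ L.toFinset} (count ℓ L + 1)` (`exists_boxForm`: affine normal form + `prod_multiset_count`), and

* `boxVolume_restoration'` — the dependent version of `boxVolume_restoration` (number of distinct forms may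
  vary with the term);
* `sigmaPiSigma_boxVolume_restoration` — **every matrix-symmetric family given at each level as
  `f n = Σ_{i<k} C (a i) * (L i).prod` with `∀ ℓ ∈ L i, ℓ.totalDegree ≤ 1` and
  `Σ_i Π_{ℓ ∈ (L i).toFinset} (count ℓ (L i) + 1) ≤ n^c + c` is quasi-polynomially orbit-restorable** — the
  shape of `stub_sigmaPiSigmaValue` / `stub_sigmaPiSigmaKValue` with the top fan-in `k` UNBOUNDED and the
  `PDClass` hypothesis replaced by the box-volume bound.

Honest label: a stratum of A_∞ (what remains: product gates of super-logarithmic distinct-form support);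
the crux and VP ≠ VNP untouched. [folklore]
-/

noncomputable section

open scoped Classical

-- `Summit.ValiantsHypothesis.ValiantsHypothesis.…` is the tree's single-conjunct layout (Sub = Summit).
set_option linter.dupNamespace false

namespace Summit.ValiantsHypothesis.ValiantsHypothesis.Theorems

namespace DerivativeTower

open MvPolynomial Finset Equiv OrbitRestorationQPDepthThreeRung WaringJennrich LevelStructure

variable {n : ℕ}

/-- Total box volume bounds the catalecticant rank (dependent number of factors per term). [folklore] -/
theorem finrank_derivChain_boxSum_le' {k : ℕ} (t : Fin k → ℕ) (a : Fin k → ℂ)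
    (w : (i : Fin k) → Fin (t i) → (Fin n × Fin n) → ℂ) (b : (i : Fin k) → Fin (t i) → ℂ)
    (e : (i : Fin k) → Fin (t i) → ℕ) (m : ℕ) :
    FiniteDimensional ℂ (derivChain (∑ i, C (a i) * ∏ j, (lin (w i j) + C (b i j)) ^ (e i j)) m) ∧
      Module.finrank ℂ (derivChain (∑ i, C (a i) * ∏ j, (lin (w i j) + C (b i j)) ^ (e i j)) m) ≤
        ∑ i, ∏ j, (e i j + 1) := by
  have hT := fun i => finrank_derivChain_prodAffPow_le (t i) (w i) (b i) (e i) m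
  have hle : derivChain (∑ i, C (a i) * ∏ j, (lin (w i j) + C (b i j)) ^ (e i j)) m ≤
      ⨆ i ∈ (Finset.univ : Finset (Fin k)), derivChain (∏ j, (lin (w i j) + C (b i j)) ^ (e i j)) m :=
    (derivChain_sum_le _ _ m).trans (iSup₂_mono fun i _ => derivChain_C_mul_le (a i) _ m)
  obtain ⟨hfin, hsum⟩ := finrank_biSup_le_sum (Finset.univ : Finset (Fin k))
    (fun i => derivChain (∏ j, (lin (w i j) + C (b i j)) ^ (e i j)) m) (fun i _ => (hT i).1)
  haveI := hfin
  exact ⟨Submodule.finiteDimensional_of_le hle,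
    (Submodule.finrank_mono hle).trans (hsum.trans (Finset.sum_le_sum fun i _ => (hT i).2))⟩

/-- **Box-volume restoration, dependent form** (the number of distinct forms may vary with the term).
[folklore] -/
theorem boxVolume_restoration' (c : ℕ) : ∃ c' : ℕ,
    ∀ f : (n : ℕ) → MvPolynomial (Fin n × Fin n) ℂ, IsMatrixSymmetric f →
      (∀ n : ℕ, ∃ (k : ℕ) (t : Fin k → ℕ) (a : Fin k → ℂ) (w : (i : Fin k) → Fin (t i) → (Fin n × Fin n) → ℂ)
        (b : (i : Fin k) → Fin (t i) → ℂ) (e : (i : Fin k) → Fin (t i) → ℕ),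
          (∑ i, ∏ j, (e i j + 1)) ≤ n ^ c + c ∧
          f n = ∑ i, C (a i) * ∏ j, (lin (w i j) + C (b i j)) ^ (e i j)) →
      ∀ n : ℕ, QPOrbitRestorable c' n (f n) := by
  obtain ⟨c', hc'⟩ := catalecticant_restoration c
  refine ⟨c', fun f hsym hf n => hc' f hsym (fun n m => ?_) n⟩
  obtain ⟨k, t, a, w, b, e, hvol, hfn⟩ := hf n
  have h := finrank_derivChain_boxSum_le' t a w b e m
  rw [← hfn] at h
  exact ⟨h.1, h.2.trans hvol⟩

/-- **Box form of a multiset of affine forms.**  A multiset `L` of polynomials of total degree `≤ 1` has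
`L.prod = Π_{j<t} (ℓ_{w_j} + b_j)^{e_j}` with `t = |L.toFinset|` pairwise distinct forms and
`Π_j (e_j + 1) = Π_{ℓ ∈ L.toFinset} (count ℓ L + 1)`. [folklore] -/
theorem exists_boxForm (L : Multiset (MvPolynomial (Fin n × Fin n) ℂ)) (hL : ∀ ℓ ∈ L, ℓ.totalDegree ≤ 1) :
    ∃ (t : ℕ) (w : Fin t → (Fin n × Fin n) → ℂ) (b : Fin t → ℂ) (e : Fin t → ℕ),
      L.prod = ∏ j, (lin (w j) + C (b j)) ^ (e j) ∧
      ∏ j, (e j + 1) = ∏ ℓ ∈ L.toFinset, (L.count ℓ + 1) := by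
  set S := L.toFinset with hS
  let σ : S ≃ Fin S.card := S.equivFin
  let form : Fin S.card → MvPolynomial (Fin n × Fin n) ℂ := fun j => (σ.symm j).1
  refine ⟨S.card, fun j x => coeff (Finsupp.single x 1) (form j), fun j => coeff 0 (form j),
    fun j => L.count (form j), ?_, ?_⟩
  · have haff : ∀ j, lin (fun x => coeff (Finsupp.single x 1) (form j)) + C (coeff 0 (form j)) = form j := by
      intro j
      have hmem : form j ∈ L := Multiset.mem_toFinset.mp (σ.symm j).2
      rw [add_comm]
      exact (HomogTools.eq_C_add_sum_of_totalDegree_le_one (hL _ hmem)).symm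
    simp_rw [haff]
    rw [Finset.prod_multiset_count L, ← Finset.prod_coe_sort S]
    exact Fintype.prod_equiv σ
      (fun x : S => (x : MvPolynomial (Fin n × Fin n) ℂ) ^ L.count (x : MvPolynomial (Fin n × Fin n) ℂ))
      (fun j => form j ^ L.count (form j)) fun x => by simp [form]
  · rw [← Finset.prod_coe_sort S]
    exact (Fintype.prod_equiv σ (fun x : S => L.count (x : MvPolynomial (Fin n × Fin n) ℂ) + 1)
      (fun j => L.count (form j) + 1) fun x => by simp [form]).symm

/-- **THE BOX-VOLUME STRATUM OF A_∞ IN THE STUB'S CURRENCY (unconditional).**  Every matrix-symmetric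
family given at each level as a sum of scaled products of multisets of affine forms,
`f n = Σ_{i<k} C (a i) * (L i).prod`, `∀ ℓ ∈ L i, ℓ.totalDegree ≤ 1`, whose total box volume
`Σ_i Π_{ℓ ∈ (L i).toFinset} (count ℓ (L i) + 1)` is `≤ n^c + c`, is quasi-polynomially orbit-restorable
(top fan-in `k` unbounded; no `PDClass` / rank-bound hypothesis). [folklore] -/
theorem sigmaPiSigma_boxVolume_restoration :
    ∀ f : (n : ℕ) → MvPolynomial (Fin n × Fin n) ℂ, IsMatrixSymmetric f →
      (∃ c : ℕ, ∀ n : ℕ, ∃ (k : ℕ) (a : Fin k → ℂ) (L : Fin k → Multiset (MvPolynomial (Fin n × Fin n) ℂ)),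
          (∀ i, ∀ ℓ ∈ L i, ℓ.totalDegree ≤ 1) ∧
          (∑ i, ∏ ℓ ∈ (L i).toFinset, ((L i).count ℓ + 1)) ≤ n ^ c + c ∧
          f n = ∑ i, C (a i) * (L i).prod) →
      ∃ c : ℕ, ∀ n : ℕ, QPOrbitRestorable c n (f n) := by
  intro f hsym ⟨c, hc⟩
  obtain ⟨c', hc'⟩ := boxVolume_restoration' c
  refine ⟨c', hc' f hsym fun n => ?_⟩
  obtain ⟨k, a, L, hdeg, hvol, hfn⟩ := hc n
  have hbox := fun i => exists_boxForm (L i) (hdeg i)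
  choose t w b e hprod hcount using hbox
  refine ⟨k, t, a, w, b, e, ?_, ?_⟩
  · calc (∑ i, ∏ j, (e i j + 1)) = ∑ i, ∏ ℓ ∈ (L i).toFinset, ((L i).count ℓ + 1) :=
          Finset.sum_congr rfl fun i _ => hcount i
      _ ≤ n ^ c + c := hvol
  · rw [hfn]
    exact Finset.sum_congr rfl fun i _ => by rw [hprod i]

end DerivativeTower

end Summit.ValiantsHypothesis.ValiantsHypothesis.Theorems

end
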